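import Summits.QuantumFields.YangMills.Theorems.LuscherReductionDressedRitzPolyakovLiftEuclideanCurrency
import Summits.QuantumFields.YangMills.Theorems.LuscherReductionDressedRitzPolyakovLiftRawVacuum
import Summits.QuantumFields.YangMills.Theorems.LuscherReductionDressedRitzVacuumDictionaryLimits
import HarnessLib

/-!
# Route `LuscherReduction`, item `DressedRitz` (stmt-QuantumFields-20205), line «polyakovlift» r5 — the normalised connected correlator `corr` IS the
# limit of free-boundary SLAB path-integral ratios (vacuum dictionary at a raw vacuum)

Support module (LEAD prover ym-lead-20205-polyakovlift g0; `--supports stmt-QuantumFields-20205`, helper).  Companion of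
`…PolyakovLiftEuclideanCurrency.lean` (`corr`, `EuclideanChannelUniversalityAt`, `channelUniversality_of_euclidean`): for a RAW vacuum `φ` (any
physical unit top eigenvector — it is its own vacuum package, `PolyakovLift.isVacuum_of_isRawVacuum`) and physical insertions `G_i`,

  `⟨(G_i − c_i)Φ_m, K^[t]((G_l − c_l)Φ_m)⟩ / ⟨Φ_m, K^[t]Φ_m⟩ ⟶ corr β φ G t i l`   (`m → ∞`; `Φ_m = slabGround β m = K^m 1`, `c_i = ⟨φ, G_iφ⟩`),

i.e. every number in S-UNIV′'s Euclidean form (E5)/(E6′) is the limit of a ratio of two FREE-BOUNDARY SLAB path integrals on `L³ × (2m + t)` with two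
constant-subtracted insertions at separation `t ∈ {2L, 2L+1}` — the objects a Bałaban-type small-field expansion estimates, uniformly in `m`.  (W1-B's
remaining deliverable: the ε-quantified finite-slab form and the limit passage.)

* `ins_eq_sub_const_mul` — `ins φ G = (G − c)·φ`, `c = ⟨φ, Gφ⟩` (definitional);
* ★ `tendsto_corr` — the limit statement (tree `VacDict.tendsto_feynmanKac` at the package of `φ`, `l2Form_one_ne_zero_of_isRawVacuum`).

HONEST FRAMING: fixed-lattice functional analysis on the conditional femto rung R2b1; no renormalisation-group content; nothing here bears on infinite
volume, the continuum limit or the Clay gap.  References: E. Seiler, LNP 159 [cite: SeilerLNP1982, §3]; Reed–Simon IV [cite: ReedSimonIV1978, Thm XIII.43].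
-/

set_option autoImplicit false

noncomputable section

open MeasureTheory Filter Topology Real
open Literature.MathematicalPhysics.QuantumFieldTheory (GaugeConfig Site gaugeTransform)
open scoped BigOperators

namespace Summit.QuantumFields.YangMills.Theorems.FemtoTransferGap.PolyakovLift

open Summit.QuantumFields.YangMills.Theorems.FemtoTransferGap
open Summit.QuantumFields.YangMills.Theorems.FemtoTransferGap.VacDict

/-- `ins φ G = (G − ⟨φ,Gφ⟩)·φ` with the constant written as a function. [folklore] -/
theorem ins_eq_sub_const_mul {M : ℕ} [NeZero M] (φ G : GaugeConfig 3 M SU2 → ℝ) :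
    OpPlat.ins φ G = (G - fun _ => l2 φ (G * φ)) * φ := rfl

/-- ★ **`corr` is the limit of free-boundary slab ratios**: for a raw vacuum `φ`, physical insertions `G`, every `t` and `i, l`:
`⟨(G_i − c_i)Φ_m, K_β^[t]((G_l − c_l)Φ_m)⟩ / ⟨Φ_m, K_β^[t]Φ_m⟩ → corr β φ G t i l` as `m → ∞` (`β ≥ 0`). [cite: SeilerLNP1982, §3] -/
theorem tendsto_corr {M : ℕ} [NeZero M] {k : ℕ} {β : ℝ} (hβ : 0 ≤ β) {φ : GaugeConfig 3 M SU2 → ℝ} (hφ : IsRawVacuum β φ)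
    {G : Fin k → (GaugeConfig 3 M SU2 → ℝ)} (hG : ∀ i, IsPhys (G i)) (t : ℕ) (i l : Fin k) :
    Tendsto (fun m : ℕ =>
        l2 ((G i - fun _ => l2 φ (G i * φ)) * slabGround (L := M) β m)
            ((transferApply β)^[t] ((G l - fun _ => l2 φ (G l * φ)) * slabGround β m)) /
          l2 (slabGround (L := M) β m) ((transferApply β)^[t] (slabGround β m)))
      atTop (𝓝 (corr β φ G t i l)) := by
  obtain ⟨Ω, θ, c, hV, hc, hcle⟩ := exists_isVacuum (L := M) β
  have hV' : IsVacuum β ⟨φ, hφ.1⟩ θ := isVacuum_of_isRawVacuum hV hφ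
  have hΩ1 : l2Form M ⟨φ, hφ.1⟩ one ≠ 0 := l2Form_one_ne_zero_of_isRawVacuum hV hc hcle hφ
  have hfi : IsPhys (G i - fun _ => l2 φ (G i * φ)) := OpPlat.isPhys_sub (hG i) (isPhys_const _)
  have hfl : IsPhys (G l - fun _ => l2 φ (G l * φ)) := OpPlat.isPhys_sub (hG l) (isPhys_const _)
  have h := tendsto_feynmanKac hV' hβ hΩ1 hfi hfl t
  simpa only [corr, ins_eq_sub_const_mul] using h

end Summit.QuantumFields.YangMills.Theorems.FemtoTransferGap.PolyakovLift

end
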